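import Mathlib
import HarnessLib
import HarnessLib.Audit
import Summits.Schanuel.Statement
import Literature.NumberTheory.Transcendental.ZilberField
import Literature.NumberTheory.Transcendental.Zilber

/-!
Route: Zilber

CLOSED (retired) 2026-08-15T16:14:44Z by planner-rbadge-Schanuel-Zilber-030a6777-g4-0 — reason: not-a-thesis — note: not-a-thesis (route-repair rbadge g4: glue.missing/extra-hypothesis + cone guardrail). X = ZilberThesis := ZilberConjecture = IsZilberField ℂ CONTAINS the summit as a conjunct: Lean theorem zilberConjecture_iff_schanuelConjecture_and_isStronglyExpAlgClosed (ZilberProofs.lean:232) gives X ↔ SchanuelP. The file is kept as the record of this route; refuted decls are indexed as negative knowledge (`ledger negatives`).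

# Route Schanuel/Zilber — ℂ_exp is Zilber's pseudo-exponential field 𝔹 (conditioning route)

## Thesis X
Words: the complex exponential field satisfies Zilber's axioms (ACF₀, standard kernel, exp
surjective,
Schanuel property, strong exponential-algebraic closedness, countable closure property);
equivalently
(Zilber2005 Thm 1.1 categoricity + existence) ℂ_exp ≅ 𝔹_{2^ℵ₀}.
Lean: `Literature.NumberTheory.Transcendental.ZilberConjecture` (:=
`Literature.NumberTheory.Transcendental.IsZilberField ℂ`; exists, Literature/…/Zilber.lean).

## Assembly X → Schanuel
Projection `IsZilberField.schanuelProperty` and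
`Literature.ModelTheory.ExponentialFields.SchanuelProperty ℂ ↔ Schanuel` (`Iff.rfl`, checked).

## Why this line, honestly (imports: categoricity in L_{ω₁,ω}, Hrushovski amalgamation)
This route is CIRCULAR as a proof of Schanuel: SP is one of the axioms, and BaysKirby2018 (Thms 1.1,
1.3 and §9) build quasiminimal EAC fields with standard kernel and CCP but WITHOUT SP, so no
combination of the other axioms forces SP. Its value is conditioning and cross-checking:
(i) `zilberConjecture ↔ Schanuel ∧ SEAC(ℂ)` given the proved/checkable facts ACF, standard kernel
(Lindemann), surjectivity, CCP (Zilber2005 Lemma 5.12) and Kirby2013 (SEAC may be weakened to EAC);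
(ii) EAC(ℂ) — "every rotund free variety meets the graph of exp" — is an analytic/Nevanlinna-type
existence problem with real progress (BrownawellMasser2017; Marker, Mantova,
D'Aquino–Fornasiero–Terzo,
Gallinaro for classes of varieties) and is the one crux here that another field (complex analytic
geometry, zero estimates with moving targets) can settle; (iii) under EAC, ℂ_exp is quasiminimal
(BaysKirby2018 Thm 1.3, in tree as fact `isQuasiminimal_of_isExpAlgClosed`) and Schanuel reduces to
its restriction to ecl(∅) — the shared crux with route EclCore. PROBLEMS.md §3 lists this line
first;
the survey records why it cannot stand alone.

## Ranked cruxes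
2. `Literature.NumberTheory.Transcendental.IsExpAlgClosed ℂ` (EAC for ℂ_exp) — hardest informative,
non-circular.
3. Schanuel on ecl(∅) (identical signature to EclCore #0; ledger dedup attaches it).
4. `Literature.ModelTheory.ExponentialFields.Language.expRing.IsQuasiminimal ℂ` (Zilber's weak
conjecture; follows from crux 2 by a fact).
5. Conditional assembly: Kirby2013 reduction + CCP + standard kernel facts + EAC + Schanuel → X
   (staffable now: pure bookkeeping over existing named facts).
6. ¬EAC(ℂ) — negative side; refutes Zilber's conjecture outright.

## Kill criteria
¬EAC(ℂ) or ¬quasiminimality proved ⇒ close route (Zilber's conjecture false; Schanuel untouched).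
Schanuel refuted ⇒ close.

## Not decomposed yet
EAC by variety class (curves in G¹ done; depth of the open part = rotund varieties of dim n ≥ 2 not
dominating additive/multiplicative projections); automorphisms of ℂ_exp; generic-kernel variants.

Novelty: NOVELTY (retriage 2026-08-14; searched: lit search "exponential algebraic closedness", lit frontier
Schanuel --since 2020, barrier catalogue (9 entries); read: Aslanyan2024 doi:10.2140/mt.2024.3.599
pp.7–10, AslanyanGallinaro2024 arXiv:2409.12860 pp.13–15, AslanyanKirbyMantova2021 arXiv:2105.12679
pp.4, 21, MantovaMasser2023 arXiv:2303.05592 pp.3–4, Gallinaro2022 arXiv:2203.13767 p.2). Nearest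
prior art = the route IS Zilber's programme: Zilber2005PseudoExp (axioms, Thm 1.1, Conjecture);
BaysKirby2018ANT arXiv:1512.04262 Thm 1.4 ('ℂ_exp ≅ 𝔹 iff SC and SEAC') = rationale (i) [print has
SEAC; EAC replaces it only under CIT: KirbyZilber2014 Thm 1.5, Aslanyan2024 p.8], Thm 1.5 (EAC ⇒
quasiminimal) = item QuasiminimalComplexExp, §9.2 (the other axioms do not force SP) = the admitted
circularity; crux EacComplex = Zilber's EC conjecture, state of the art AslanyanGallinaro2024 §3.4:
n=1 (Marker2006), dominant additive projection (BrownawellMasser2017 Prop 2;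
AslanyanKirbyMantova2021 Thm 1.5), dim π₁V = 1 (MantovaMasser2023 Thm 1.1) hence all of ℂ²×(ℂˣ)²,
L×W (Gallinaro2022 Thm 8.8); open: n ≥ 3, non-dominant, non-split. Delta: none in mechanism
(expected grade: known); the route adds only Lean bookkeeping — X ↔ Schanuel ∧ EAC(ℂ) modulo named
facts (one CIT-conditional) — and isolates EAC(ℂ) as its single non-circular item;
AslanyanGallinaro2024 p.15: 'no known implications between Schanuel's conjecture and Exponential
Closedness (and it is not expected that there are any)'.  [refs: 10.2140/mt.2024.3.599, 2409.12860, 2105.12679, 2303.05592, 2203.13767, 1512.04262, doi:10.2140/mt.2024.3.599, Aslanyan2024, AslanyanGallinaro2024, AslanyanKirbyMantova2021, MantovaMasser2023, Gallinaro2022, KirbyZilber2014, Marker2006, BrownawellMasser2017]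

Barriers (technique_class: categoricity zilber-axioms exponential-algebraic-closedness): BARRIERS (the 9 Schanuel catalogue entries examined; technique_class: categoricity zilber-axioms
exponential-algebraic-closedness).
- Literature.Barriers.Schanuel.AxiomsDoNotForceSchanuel [categoricity zilber-axioms
quasiminimality]: APPLIES, NOT evaded. Bays–Kirby's 𝔹_P (BaysKirby2018ANT §9.2;
not_softDerivationOfSchanuel, PROVED from the tree fact baysKirby2018_modelsWithoutSchanuel) have
ELA + standard kernel + axiom 4 + CCP + quasiminimality and ¬SP, so EacComplex,
QuasiminimalComplexExp and the CCP/kernel facts say nothing about SP, and the Assembly projects an X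
that already contains SP. CIRCULAR conditioning route (header says so); as a proof of the summit the
bet is nil (AslanyanGallinaro2024 p.15: no EC⇔SC implication expected).
- Literature.Barriers.Schanuel.SchanuelPropertyNotFirstOrder [first-order-transfer]: hits any
shortcut to SP(ℂ) from Th(ℂ_exp) or 'ℂ_exp ≡ 𝔹' (Kirby2013Axioms Thm 1 needs the L_{ω1,ω}(Q) axioms
incl. SP); not evaded; constrains provers of the target, not of EacComplex.
- Literature.Barriers.Schanuel.AxSchanuelFunctionalNotNumerical [functional-transcendence]: blocks
deriving the SP conjunct (EclcoreThesis ⇔ Schanuel) from Ax–Schanuel; EAC proofs use Ax–Schanuel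
only for rotundity/dimension counts (Gallinaro2022 §3) — untouched.
- The six transcendence-method scope entries (AlgebraicIndependenceOfLogarithms …
PeriodConjectureOverQbarScope) bound SP-side methods, not EAC(ℂ), a complex-analytic existence
problem; no SP-side crux is filed here.

History (route lifecycle, newest last):
- 2026-08-15T16:14:44Z · CLOSED retired — not-a-thesis (planner-rbadge-Schanuel-Zilber-030a6777-g4-0)

sub-problem: Schanuel · status: closed(retired) · opened planner-Schanuel-Survey-0 2026-08-13T06:03:33Z · rev 2 · ledger route-Schanuel-Zilber
GENERATED by the gate from the ledger (D-0016/17). Provers cite these decls: `theorem foo : Summit.Schanuel.Schanuel.Theses.Zilber.<Decl> := …` in Summits/Schanuel/Schanuel/Theorems/<Name>.lean.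
-/

namespace Summit.Schanuel.Schanuel.Theses.Zilber

open scoped BigOperators Topology Manifold Classical MeasureTheory ProbabilityTheory Matrix InnerProductSpace ComplexConjugate ContinuousMap
open Filter Set Function TopologicalSpace MeasureTheory

attribute [summit_statement] _root_.Schanuel

open Literature.Periods

/-- item stmt-Schanuel-0072 · target · rank 0 · closed · moot by None · by planner
why it might fail: X ⇔ SC ∧ SEAC(ℂ) (BaysKirby2018ANT Thm 1.4): X contains the summit; independently X fails if SEAC(ℂ) fails or if ℝ is L_exp-definable in ℂ (kills quasiminimality; open); EAC⇒SEAC is known only under CIT (KirbyZilber2014 Thm 1.5); no SC⇔EC implication is expected (AslanyanGallinaro2024 p.15).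
sources: BaysKirby2018ANT arXiv:1512.04262 p.3 Thm 1.4 ('Conjecture 1.3 [ℂ_exp ≅ 𝔹] is true iff Schanuel's conjecture is true and ℂ_exp is strongly exponentially-algebraically closed'); §9.2 (models 𝔹_P with all the other axioms and ¬SP), Literature.Barriers.Schanuel.AxiomsDoNotForceSchanuel (AxiomsDoNotForceSchanuel.lean:301; not_softDerivationOfSchanuel :273 PROVED from fact baysKirby2018_modelsWithoutSchanuel :128): the other Zilber axioms + quasiminimality do not force SP, KirbyZilber2014 arXiv:1108.1075 Thm 1.5 (= Thm 5.7), §5: EAC replaces SEAC only assuming CIT; Lean: Literature.NumberTheory.Transcendental.IsZilberField.of_isExpAlgClosed_of_cit (IntersectionsWithTori.lean:448), fact kirbyZilber2014_isStronglyExpAlgClosed_of_isExpAlgClosed (:436), AslanyanGallinaro2024 arXiv:2409.12860 p.15: 'There are no known implications between Schanuel's conjecture and Exponential Closedness (and it is not expected that there are any)', Zilber2005PseudoExp doi:10.1016/j.apal.2004.07.001 Thm 1.1 / Conjecture p.68; Kirby2013Axioms arXiv:1006.0894 §2 axioms 1–5 = the six fields of Literature.NumberTheory.Transcendental.IsZilberField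 (grounder-verified 2026-08-14), Lean: X = Literature.NumberTheory.Transcendental.ZilberConjecture := IsZilberField ℂ (Zilber.lean:97); Assembly term `fun h => h.schanuelProperty : ZilberConjecture → Schanuel` checked rc0 by refuters 2026-08-13
IsZilberField ℂ: ACF₀ + standard kernel + exp surjective + Schanuel property + SEAC + CCP. CIRCULAR
for Schanuel (SP is an axiom); conditioning route. Sources: Zilber2005 Thm 1.1 & Conj. p.68,
BaysKirby2018 §1, Kirby2013. -/
@[route_item "route-Schanuel-Zilber"]
def ZilberThesis : Prop :=
  Literature.NumberTheory.Transcendental.ZilberConjecture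

/-- item stmt-Schanuel-0074 · crux · rank 2 · closed · moot by None · by planner
why it might fail: Open exactly for n≥3, 2≤dim π_add(V)≤n−1, V not split L×W (n≤2 done: BM17 Prop 2 + MantovaMasser2023 Thm 1.1; dominant: BM17, AKM21; L×W: Gallinaro2022 Thm 8.8). Off-dominant 'any analogous F can oscillate or grow too fast' (AKM21 §6): one free rotund non-dominant 3-fold missing Γ_exp refutes it.
sources: AslanyanGallinaro2024 arXiv:2409.12860 p.1 'open in full generality'; §3.4 p.14: Thm 3.7 (n=1; Marker2006), Thm 3.8 = BrownawellMasser2017 Prop 2 (dim π₁V = n), Thm 3.9 = MantovaMasser2023 Thm 1.1 (dim π₁V = 1, no vertical projections) ⇒ 'imply Conjecture 3.4 for all subvarieties of ℂ²×(ℂˣ)²', AslanyanKirbyMantova2021 arXiv:2105.12679 (IMRN 2023, doi:10.1093/imrn/rnab340) p.4 Thm 1.5 (dominant additive projection, new proof) and §6 p.21 ('Relaxing the assumption … dominant seems more difficult … any analogous function F we define can oscillate or grow too fast'), MantovaMasser2023 arXiv:2303.05592 (PLMS 129, 2024) p.3 Thm 1.1 (dim π(V) = 1, no additive relation (AF)),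 Thm 1.2 (surfaces in ℂ²×(ℂˣ)²: 'conclusive result'), Gallinaro2022 arXiv:2203.13767 (Selecta Math. 2023) Thm 8.8: V = L×W additively free rotund with L linear contains an exponential point; §3 uses Ax–Schanuel only for rotundity/dimension counts, Aslanyan2024 doi:10.2140/mt.2024.3.599 p.7 Conj 2.4 (EC), p.8 ('SEC implies EC. The converse is also true assuming SC and CIT'), p.9 ('while EC is more tractable, it is also open'), p.10 (list of partial results), Lean: Literature.NumberTheory.Transcendental.IsExpAlgClosed (ZilberField.lean:235); refuter audit 2026-08-13: rotund/free/zariskiDim faithful to Zilber2005PseudoExp §1 / Kirby2013Axioms Def 2.6, no junk at n=0,1; not_isExpAlgClosed_real (ExpAlgClosedDiagonal.lean:438) shows the notion has teeth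
Every irreducible rotund, additively and multiplicatively free subvariety V ⊆ ℂⁿ×(ℂˣ)ⁿ of dimension
n meets the graph of exp. Open; known for many classes (curves n=1: Marker; BrownawellMasser2017
zero estimates with moving targets; D'Aquino–Fornasiero–Terzo; Gallinaro; Mantova–Masser).
Non-circular, analytic. Sources: Zilber2005 §1 (EC), Kirby2013, BrownawellMasser2017. -/
@[route_item "route-Schanuel-Zilber"]
def EacComplex : Prop :=
  Literature.NumberTheory.Transcendental.IsExpAlgClosed ℂ

/-- item stmt-Schanuel-0075 · crux · rank 4 · closed · moot by None · by planner
why it might fail: Zilber's WEAK conjecture, open: false iff some L_exp-definable S ⊆ ℂ is uncountable and co-uncountable, e.g. if ℝ were definable in ℂ_exp (open; Gallinaro2022 p.2). Every engine in print is conditional: EAC ⇒ QM (BK18 Thm 1.5, proved in tree), WACP ⇒ QM (Wilkie2024 Thm 3; WACP known for N=1 only).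
sources: BaysKirby2018ANT arXiv:1512.04262 p.3 Conj 1.1 (Zilber's quasiminimality conjecture) = Literature.ModelTheory.ExponentialFields.Language.expRing.IsQuasiminimal ℂ (grounder-verified 2026-08-14; = ZilberQuasiminimalityConjecture by Iff.rfl: Zilber.lean zilberQuasiminimalityConjecture_iff), Wilkie2024 doi:10.2140/mt.2024.3.701 = arXiv:2306.14562 (Model Theory 3), read pp.2,9,11: Thm 3 'If E has the WACP then … in particular C_exp is quasiminimal'; WACP proved only for N=1 (p.11 'a very special case'); p.2 'still unresolved' — o-minimal/analytic-continuation line INDEPENDENT of EAC, BaysKirby2018ANT Thm 1.5 (EAC ⇒ quasiminimal) PROVED in tree: Literature.NumberTheory.Transcendental.isQuasiminimal_of_isExpAlgClosed_holds (ZilberThm15.lean:74) — crux EacComplex ⇒ this item; converse unknown, so the item is strictly weaker, Boxall2020 Quart. J. Math. 71(3) 1065-1068 'A special case of quasiminimality for the complex exponential field' (quoted Wilkie2024 p.11): projections π₁(Z(P)) of exponential-term zero sets are countable or co-countable, GallinaroKirby2024 doi:10.1017/fms.2024.82 = arXiv:2304.06450 Thm 1.2: complex powers ⟨ℂ; +,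 ·, (Γ_λ)⟩, a reduct of ℂ_exp, is quasiminimal — 'the most significant result yet proved towards' Conj 1.1, Gallinaro2022 arXiv:2203.13767 p.2: 'there is no obvious way to define … the real numbers in ℂ_exp'; Wilkie2024 p.11 (Koiran): no non-quasiminimal expansion of ℂ by finitely many entire functions of one variable is known
Every L_exp-definable (with parameters) subset of ℂ is countable or co-countable. Open; follows from
#2 by BaysKirby2018 Thm 1.3 (in tree as fact
Literature.NumberTheory.Transcendental.isQuasiminimal_of_isExpAlgClosed); =
Literature.ModelTheory.ExponentialFields.ZilberQuasiminimalityConjecture by Iff.rfl. Sources: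
Zilber2005 Thm 1.2, BaysKirby2018 Thm 1.1/1.3. -/
@[route_item "route-Schanuel-Zilber"]
def QuasiminimalComplexExp : Prop :=
  Literature.ModelTheory.ExponentialFields.Language.expRing.IsQuasiminimal ℂ

/-- item stmt-Schanuel-0066 · support · rank 3 · closed · moot by None · by planner
why it might fail: It is Schanuel's conjecture itself (⇔ by Kirby2010EAEF Prop 7.2; PROVED in tree: Literature.NumberTheory.Transcendental.schanuelConjecture_iff_ecl_empty_holds); already n=2 at (1, πi) gives e, π algebraically independent — open (AslanyanGallinaro2024 p.15, Aslanyan2024 p.6).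
sources: Kirby2010EAEF arXiv:0810.4285 p.11 Prop 7.2 (essential counterexamples to SC lie in ecl(∅)), Thm 1.4; Lean: Literature.NumberTheory.Transcendental.schanuelConjecture_iff_ecl_empty_holds (KirbyWeakSchanuelAx.lean:578, proved from Literature.NumberTheory.Transcendental.ax_schanuel_holds), route-Schanuel-EclCore: the same item is its rank-0 target (wanted_by kind target there) — staffing belongs to that route's cruxes, Literature.Barriers.Schanuel.AxSchanuelFunctionalNotNumerical (AxSchanuelFunctionalNotNumerical.lean:363): functional transcendence is silent on ecl(∅) ∋ e, π, log 2
Schanuel's conjecture restricted to ℚ-linearly independent tuples with all entries in E = ecl^ℂ(∅)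
(Kirby's exponential-algebraic closure of ∅: coordinates of non-degenerate solutions of Khovanskii
systems over ℤ). Equivalent to Schanuel by Kirby2010 Thm 1.2–1.3 (from Ax1971). Sources: Kirby2010,
Ax1971, Zilber2005 §5. -/
@[route_item "route-Schanuel-Zilber"]
def EclcoreThesis : Prop :=
  ∀ (n : ℕ) (x : Fin n → ℂ), (∀ i, x i ∈ Literature.NumberTheory.Transcendental.ecl (∅ : Set ℂ)) → LinearIndependent ℚ x → (n : Cardinal) ≤ Algebra.trdeg ℚ ↥(IntermediateField.adjoin ℚ (Set.range x ∪ Set.range (Complex.exp ∘ x)))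

/-- item stmt-Schanuel-0076 · support · rank 5 · closed · moot by None · by planner
sources: Lean: hypothesis Literature.NumberTheory.Transcendental.IsZilberField.of_isExpAlgClosed (ZilberField.lean:436; open unconditionally, CIT-conditional via KirbyZilber2014 Thm 1.5 = Literature.NumberTheory.Transcendental.IsZilberField.of_isExpAlgClosed_of_cit, IntersectionsWithTori.lean:448), KirbyZilber2014 arXiv:1108.1075 Thm 1.5 (= Thm 5.7); Kirby2013Axioms arXiv:1006.0894 p.3 Thm 1 is 'ℂ_exp ≡ 𝔹 ⇒ ℂ_exp ≅ 𝔹', NOT an EAC⇒SEAC reduction (grounder reground MISMATCH 2026-08-14T02:41Z on this item), refuter note 2026-08-13: closes now by `fun hK hccp hker heac hS => hK Complex.isAlgClosed hker Literature.ModelTheory.ExponentialFields.ExponentialRing.isSurjectiveOntoUnits_complex hS heac hccp` (rc0)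
Bookkeeping over existing named facts: with Complex.isAlgClosed and
Literature.ModelTheory.ExponentialFields.ExponentialRing.isSurjectiveOntoUnits_complex (proved),
Kirby2013 Thm 1 assembles IsZilberField ℂ from EAC + SP + CCP + standard kernel. Staffable now;
records ZilberConjecture ↔ EAC ∧ Schanuel modulo facts. Sources: Kirby2013 Thm 1, Zilber2005 Lemma
5.12. -/
@[route_item "route-Schanuel-Zilber"]
def ZilberOfEacAndSchanuel : Prop :=
  (Literature.NumberTheory.Transcendental.IsZilberField.of_isExpAlgClosed (K := ℂ)) → Literature.NumberTheory.Transcendental.hasCountableClosureProperty_complex → Literature.NumberTheory.Transcendental.hasStandardKernel_complex → Literature.NumberTheory.Transcendental.IsExpAlgClosed ℂ → Schanuel → Literature.NumberTheory.Transcendental.ZilberConjecture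

/-- item stmt-Schanuel-0077 · support · rank 6 · closed · moot by None · by planner
why it might fail: Believed false (Zilber conjectures EAC; no printed source conjectures ¬EAC); no witness variety known or proposed; any witness needs n ≥ 3 with 2 ≤ dim π_add ≤ n−1, non-split (n ≤ 2, dominant and L×W cases of EAC are theorems: BM17, MantovaMasser2023, AslanyanKirbyMantova2021, Gallinaro2022).
sources: AslanyanGallinaro2024 arXiv:2409.12860 p.14: EC holds for all subvarieties of ℂ²×(ℂˣ)² (BrownawellMasser2017 Prop 2 + MantovaMasser2023 Thm 1.1) — so a witness lives in n ≥ 3, BaysKirby2018ANT arXiv:1512.04262 §10.2–10.3 pp.32–33: EAC(ℂ_exp) open, only positive partial results; no printed source conjectures ¬EAC (grounder reground 2026-08-14), refuter notes 2026-08-13 on stmt-Schanuel-0074/0077: definitional escape hatches (torusLocus/expGraph/IsRotund/IsAddFree/IsMulFree/zariskiDim) audited, none; n=0 provably true, n=1 = Marker2006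
Negative side of #2: exhibit a rotund free n-dimensional variety missing the graph of exp. Sources:
Zilber2005 §1, Kirby2013. -/
@[route_item "route-Schanuel-Zilber"]
def NotEacComplex : Prop :=
  ¬ Literature.NumberTheory.Transcendental.IsExpAlgClosed ℂ

/-- item stmt-Schanuel-0073 · assembly · rank 1 · closed · moot by None · by planner
Projection IsZilberField.schanuelProperty; Literature.ModelTheory.ExponentialFields.SchanuelProperty
ℂ ↔ Schanuel is Iff.rfl (checked in sketch). Staffable now. Sources: Zilber2005 §1. -/
@[route_item "route-Schanuel-Zilber"]
def Assembly : Prop :=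
  Literature.NumberTheory.Transcendental.ZilberConjecture → Schanuel

end Summit.Schanuel.Schanuel.Theses.Zilber
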